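import Summits.BirchSwinnertonDyer.BirchSwinnertonDyer.Theorems.MordellShaFreeCutKatoZetaRoadPinnedH2
import HarnessLib

set_option linter.dupNamespace false
set_option autoImplicit false

/-! # Route `MordellShaFreeCut` (rung S2b) — crux B `AnalyticRankOneOfRankOneFiniteShaThree`
# (stmt-BirchSwinnertonDyer-19160): the v2-PINNED Kato–zeta / Perrin-Riou composition with the (R+K) reading asked
# only AT THE PIN (under crux B's own hypotheses `rank W(ℚ) = 1 ∧ #Ш(W)[3^∞] < ∞`)

Cell `bsd-cn100`, prover seat `bsd-cn100-s2b-c3` (g18). THEOREMS ONLY (0 `def`, 0 named fact); supports, does not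
close, stmt-BirchSwinnertonDyer-19160. Companion of this seat's `MordellShaFreeCutKatoZetaRoadPinnedH2` (g6): its
composition `heegnerNonTorsion_of_prFormulaH2_of_readings` / `cruxB_of_prFormulaH2_of_readings` displays the (R+K)
reading `hRK` («a v2-pinned Kato descent datum of `(W, 3)` with the main-conjecture-type char-ideal relation
exists») for EVERY globally minimal `j = 0` curve, but USES it only after the crux hypotheses are introduced
(`obtain ⟨D, ⟨pin⟩, hMC⟩ := hRK W hj` comes after `intro … hrank hsha`). This file re-cuts the composition so
that `hRK` is displayed exactly where it is used: for `W` with `rank W(ℚ) = 1` and `Ш(W)[3^∞]` finite. The proof is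
the same, token for token, with `hRK W hj hrank hsha`.

WHY (plan g19 RULING-5, 2026-08-27T08:24:36Z; the v1g → v1h step of the registered line `kato-zeta-perrin-riou`):
after (α) (p510488), torsion-freeness (p491527), (R1) (p508547) and (R2) (p514042
`Kato2004/IwasawaH1RankLeOneProofs.lean`), the rank-one clause of `Kato2004.thm12_4` that feeds `readingRK` is a
tree theorem UNDER THE CRUX HYPOTHESES (where `rank_{ℤ₃} H¹(ℤ[1/3], T₃W) ≤ 1`) modulo the single bit (NT)
«`𝐇¹_Γ(T₃W) ≠ 0`»; v1g's `readingRK` slot quantifies over every `j = 0` curve, where (R2) says nothing. The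
at-the-pin slot below is the one a v1h body can fill from (NT) — see the companion census
`MordellShaFreeCutKatoZetaRoadNontrivialH1` (this seat, same day), which feeds both readings from (NT) over tree
theorems and records «crux B ⟸ six refereed theorems ∧ (NT) ∧ `PRFormulaAtThreeH2`».

HONEST FRAMING: a re-cut of a landed conditional composition; every hypothesis displayed; nothing about the six
refereed inputs, the readings, `PRFormulaAtThreeH2` (OPEN, 0 sources at the additive prime `3`), crux B, the leaf
`rankOne_threeConverse_mordellCurve`, Sylvester's problem or BSD is proved. PARTITION: none — RANK axis. Build rule
(H): concludes the route decl BY NAME through the S2b-cone file `MordellShaFreeCutKatoZetaRoadPinnedH2`.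

References: [AlpogeBhargavaShnidman2022] App. A (Burungale–Skinner) Thm. 10.1, Thm. 10.6, Thm. 10.8, §10.1.3;
[BurungaleTian2026] Thm. 2.6, Thm. 3.1; [Kato2004Asterisque] Thm. 12.4, Conj. 12.10, §14.14, Cor. 14.3;
[GrossZagier1986] Thm. I.6.3.
-/

noncomputable section

open scoped Classical

open WeierstrassCurve NumberField IsDedekindDomain Field Literature.NumberTheory.EllipticCurves
  Literature.NumberTheory.EllipticCurves.Kato2004 Literature.NumberTheory.EllipticCurves.IwasawaAlgebra
  Literature.NumberTheory.EllipticCurves.Kato2004.EulerSystemValues Literature.NumberTheory.EllipticCurves.Castella2018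
  Literature.NumberTheory.GaloisRepresentations
  Summit.BirchSwinnertonDyer.Rank1Residual.Additive
  Summit.BirchSwinnertonDyer.BirchSwinnertonDyer.Theses.MordellShaFreeCut
  Summit.BirchSwinnertonDyer.BirchSwinnertonDyer.Theorems.CongruentShaFreeCutKatoDescentDatumOfH2
  Summit.BirchSwinnertonDyer.BirchSwinnertonDyer.Theorems.MordellShaFreeCutKatoZetaRoadPinnedH2
open Summit.BirchSwinnertonDyer.BirchSwinnertonDyer.Theorems.MordellShaFreeCutOfHeegnerNonTorsion
  (analyticRankOne_of_facts_of_heegnerNonTorsion)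

namespace Summit.BirchSwinnertonDyer.BirchSwinnertonDyer.Theorems.MordellShaFreeCutKatoZetaRoadPinnedH2AtPin

/-! ## §0 The `Λ`-module generator step of Burungale–Tian Thm. 3.1 on a Kato descent datum -/

section Skeleton

variable {p : ℕ} [Fact p.Prime] (D : KatoDescentDatum p)

/-- **Burungale–Tian's `Λ`-module step on a Kato descent datum** (statement and proof = the private lemma of
`MordellShaFreeCutKatoZetaRoadPinnedH2` §0, re-proved here because it is private there). If Kato's Main
Conjecture 12.10 holds for `D` in `Λ ⊗ ℚ` (`p^a · char_Λ H2 = p^b · char_Λ (H/Λz)`) and `H2/TH2` is finite, then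
`ι(z mod TH)` is not `ℤ_p`-torsion: `p^m • ι(z̄) ≠ 0` for every `m` — the Literature generator lemma
`IwasawaAlgebra.exists_forall_pow_smul_mkQ_ne_zero_of_span_pow_mul_charIdeal_eq` with `G = {z}` and the
injectivity of `ι`. [cite: BurungaleTian2026, Thm. 3.1 (proof, p. 6: (3.1)–(3.2)) and Remark 3.2]
[cite: Kato2004Asterisque, Conj. 12.10 (p. 224) and §14.14 (14.14.1) (p. 243)] -/
private theorem forall_pow_smul_iota_zeta_ne_zero
    (hMC : ∃ a b : ℕ,
      Ideal.span {(p : IwasawaAlgebra p) ^ a} * Module.charIdeal (IwasawaAlgebra p) D.H2 =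
        Ideal.span {(p : IwasawaAlgebra p) ^ b} *
          Module.charIdeal (IwasawaAlgebra p) (D.H ⧸ (IwasawaAlgebra p) ∙ D.z))
    (hfin : Finite (IwasawaAlgebra.coinvariants p D.H2)) :
    ∀ m : ℕ, p ^ m • D.ι (Submodule.Quotient.mk D.z) ≠ 0 := by
  have hG : ∃ g ∈ ({D.z} : Set D.H), g ≠ 0 := ⟨D.z, Set.mem_singleton _, D.z_ne_zero⟩
  obtain ⟨g, hg, h⟩ :=
    IwasawaAlgebra.exists_forall_pow_smul_mkQ_ne_zero_of_span_pow_mul_charIdeal_eq p hG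
      D.isTorsion_quotient D.isTorsion_H2 hMC hfin
  rw [Set.mem_singleton_iff] at hg
  subst hg
  intro m hm
  refine h m (D.ι_injective ?_)
  rw [map_nsmul, hm, map_zero]

end Skeleton

/-! ## §1 The v2-pinned composition with the (R+K) reading asked AT THE PIN -/

/-- **Heegner points of a `j = 0` curve are non-torsion at a rank-one `Ш[3^∞]`-finite datum, on the v2-pinned
Kato–zeta road, with the (R+K) reading asked only AT THE PIN.** Same conclusion, same displayed hypotheses and same
proof as `MordellShaFreeCutKatoZetaRoadPinnedH2.heegnerNonTorsion_of_prFormulaH2_of_readings` ([ABS] §10.1.3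
verbatim: rank `1` ⟹ `L(W,1) = 0` by Kato's finiteness theorem; the pinned datum with (K); (K) + (3.1′) ⟹ `ι[z]` not
`ℤ₃`-torsion; (PR₃) at an embedding over a degree-one prime; (3.1″); a torsion `P` has `log_ω(P) = 0`), EXCEPT
that `hRK` — «a v2-pinned Kato descent datum of `(W, 3)` with the main-conjecture-type relation exists» — is
required only for `W` with `rank W(ℚ) = 1` and `Ш(W)[3^∞]` finite (the crux hypotheses), which is where the proof
uses it. CONDITIONAL on the displayed hypotheses; credits nothing.
[cite: AlpogeBhargavaShnidman2022, App. A Thm. 10.1, Thm. 10.6, Thm. 10.8, §10.1.3 (pp. 33–34)]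
[cite: BurungaleTian2026, Thm. 2.6 and Thm. 3.1] [cite: Kato2004Asterisque, Thm. 12.4, Conj. 12.10, §14.14, Cor. 14.3] -/
theorem heegnerNonTorsion_of_prFormulaH2_of_readingsAtPin
    (hKato : ∀ (W : WeierstrassCurve ℚ) [W.IsElliptic] (p : ℕ) [Fact p.Prime],
      kato_finite_of_L_one_ne_zero W p)
    (hRK : ∀ (W : WeierstrassCurve ℚ) [W.IsElliptic] [W.IsGloballyMinimal]
      [ContinuousSMul ℤ_[3] (W.tateModule 3)], W.j = 0 → W.mordellWeilRank = 1 →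
        Finite (AddCommGroup.primaryComponent W.sha 3) →
        ∃ D : KatoDescentDatum 3, Nonempty (KatoDescentDatumPinH2 W 3 D) ∧
          ∃ a b : ℕ,
            Ideal.span {((3 : ℕ) : IwasawaAlgebra 3) ^ a} * Module.charIdeal (IwasawaAlgebra 3) D.H2 =
              Ideal.span {((3 : ℕ) : IwasawaAlgebra 3) ^ b} *
                Module.charIdeal (IwasawaAlgebra 3) (D.H ⧸ (IwasawaAlgebra 3) ∙ D.z))
    (h31 : ∀ (W : WeierstrassCurve ℚ) [W.IsElliptic] [W.IsGloballyMinimal]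
      [ContinuousSMul ℤ_[3] (W.tateModule 3)] (D : KatoDescentDatum 3), W.j = 0 →
        Nonempty (KatoDescentDatumPinH2 W 3 D) → W.mordellWeilRank = 1 →
          Finite (AddCommGroup.primaryComponent W.sha 3) →
            Finite (IwasawaAlgebra.coinvariants 3 D.H2))
    (h31b : ∀ (W : WeierstrassCurve ℚ) [W.IsElliptic] [W.IsGloballyMinimal]
      [ContinuousSMul ℤ_[3] (W.tateModule 3)] (D : KatoDescentDatum 3)
      (pin : KatoDescentDatumPinH2 W 3 D), W.j = 0 → W.mordellWeilRank = 1 →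
        Finite (AddCommGroup.primaryComponent W.sha 3) →
          (∀ m : ℕ, 3 ^ m • D.ι (Submodule.Quotient.mk D.z) ≠ 0) →
            ∀ t : ℚ_[3], HasLocPKummerLog W 3 pin.katoClass t → t ≠ 0)
    (hPR : PRFormulaAtThreeH2) :
    ∀ (W : WeierstrassCurve ℚ) [W.IsElliptic] [W.IsGloballyMinimal], W.j = 0 →
      ∀ (K : Type) [Field K] [NumberField K] (N : ℕ) [NeZero N], W.conductorNorm ℤ = N →
        IsImaginaryQuadratic K → SatisfiesHeegnerHypothesis N K → SatisfiesHeegnerHypothesis 3 K →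
          (W.quadraticTwist (NumberField.discr K : ℚ)).entireLFunction 1 ≠ 0 →
            W.mordellWeilRank = 1 → Finite (AddCommGroup.primaryComponent W.sha 3) →
              ∀ (P : (W.baseChange K).toAffine.Point), IsHeegnerPoint N W K P →
                ¬ IsOfFinAddOrder P := by
  intro W _ _ hj K _ _ N _ hN hK hHN hH3 hLK hrank hsha P hP hPtor
  haveI : ContinuousSMul ℤ_[3] (W.tateModule 3) := TateModule.continuousSMul_padicInt
  -- an embedding `ι : K → ℚ₃` at a degree-one prime over `3` (`3` splits in `K`)
  obtain ⟨-, -, 𝔭, -, -, h𝔭, he, hf⟩ :=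
    Summit.BirchSwinnertonDyer.Rank1Residual.X11b.exists_anticyclotomic_generator_degreeOnePrime 3 K hK hH3
  set ι : K →+* ℚ_[3] := Summit.BirchSwinnertonDyer.Rank1Residual.X11b.embAt K 3 𝔭 h𝔭 he hf with hιdef
  -- rank one ⟹ `L(W, 1) = 0` (Kato's finiteness theorem, Cor. 14.3)
  have hL : W.entireLFunction 1 = 0 := by
    by_contra hL1
    obtain ⟨hfin, -, -⟩ := hKato W 3 hL1
    have h0 : W.mordellWeilRank = 0 := mordellWeilRank_eq_zero_of_finite W hfin
    omega
  -- the pinned datum with Kato's main conjecture, AT THE PIN (crux hypotheses in hand); `ι[z]` not `ℤ₃`-torsion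
  obtain ⟨D, ⟨pin⟩, hMC⟩ := hRK W hj hrank hsha
  have hz : ∀ m : ℕ, 3 ^ m • D.ι (Submodule.Quotient.mk D.z) ≠ 0 :=
    forall_pow_smul_iota_zeta_ne_zero D hMC (h31 W D hj ⟨pin⟩ hrank hsha)
  -- Perrin-Riou's formula at `ι`, `P`, and the pinned datum
  obtain ⟨c, -, hPRx⟩ := hPR W hj K N hN hK hHN hH3 hLK ι P hP hL D pin hMC
  have ht : c * padicLogOmega W 3 ι P ^ 2 ≠ 0 := h31b W D pin hj hrank hsha hz _ hPRx
  -- but a torsion Heegner point has `log_ω(P) = 0`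
  have hlog : padicLogOmega W 3 ι P = 0 := by
    unfold padicLogOmega
    rw [AcPConverseLinks.padicLogPoint_formalIndex_smul_eq_zero_of_isOfFinAddOrder W 3 ι hPtor,
      zero_div]
  exact ht (by rw [hlog, zero_pow two_ne_zero, mul_zero])

/-- **Crux B `AnalyticRankOneOfRankOneFiniteShaThree` (stmt-BirchSwinnertonDyer-19160) on the v2-PINNED Kato–zeta /
Perrin-Riou road, readings asked AT THE PIN.** Displayed hypotheses: the six refereed facts of the line of record
(`3`-parity `hpar`, modularity `hmod`, Hoffstein–Luo `hHL`, Kato `hKato`, existence of Heegner points `hHP`,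
Gross–Zagier + Kolyvagin `hGZ`), the three print readings (R+K) `hRK` — now only under the crux hypotheses —,
(3.1′) `h31` (free pinned schema), (3.1″) `h31b`, and ONE research statement `hPR : PRFormulaAtThreeH2`. Proof:
`MordellShaFreeCutOfHeegnerNonTorsion.analyticRankOne_of_facts_of_heegnerNonTorsion` ∘
`heegnerNonTorsion_of_prFormulaH2_of_readingsAtPin`. CONDITIONAL; closes nothing.
[cite: AlpogeBhargavaShnidman2022, App. A Thm. 10.1, Thm. 10.6, Thm. 10.8, §10.1.3; §2 after Thm. 2.10]
[cite: BurungaleTian2026, Thm. 2.6] [cite: GrossZagier1986, Thm. I.6.3 with V.§2] [cite: Kato2004Asterisque, Cor. 14.3, §14.14] -/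
theorem cruxB_of_prFormulaH2_of_readingsAtPin
    (hpar : ∀ (W : WeierstrassCurve ℚ) [W.IsElliptic] (p : ℕ) [Fact p.Prime], p_parity W p)
    (hmod : ModularForms.exists_isNewformOf) (hHL : HoffsteinLuo1997_exists_twist_L_one_ne_zero)
    (hKato : ∀ (W : WeierstrassCurve ℚ) [W.IsElliptic] (p : ℕ) [Fact p.Prime],
      kato_finite_of_L_one_ne_zero W p)
    (hHP : ∀ (W : WeierstrassCurve ℚ) (K : Type) [Field K] [NumberField K],
      exists_isHeegnerPoint W K)
    (hGZ : ∀ (W : WeierstrassCurve ℚ) (N : ℕ) [NeZero N] (K : Type) [Field K] [NumberField K],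
      analyticRankEK_eq_one_iff_heegner_nonTorsion W N K)
    (hRK : ∀ (W : WeierstrassCurve ℚ) [W.IsElliptic] [W.IsGloballyMinimal]
      [ContinuousSMul ℤ_[3] (W.tateModule 3)], W.j = 0 → W.mordellWeilRank = 1 →
        Finite (AddCommGroup.primaryComponent W.sha 3) →
        ∃ D : KatoDescentDatum 3, Nonempty (KatoDescentDatumPinH2 W 3 D) ∧
          ∃ a b : ℕ,
            Ideal.span {((3 : ℕ) : IwasawaAlgebra 3) ^ a} * Module.charIdeal (IwasawaAlgebra 3) D.H2 =
              Ideal.span {((3 : ℕ) : IwasawaAlgebra 3) ^ b} *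
                Module.charIdeal (IwasawaAlgebra 3) (D.H ⧸ (IwasawaAlgebra 3) ∙ D.z))
    (h31 : ∀ (W : WeierstrassCurve ℚ) [W.IsElliptic] [W.IsGloballyMinimal]
      [ContinuousSMul ℤ_[3] (W.tateModule 3)] (D : KatoDescentDatum 3), W.j = 0 →
        Nonempty (KatoDescentDatumPinH2 W 3 D) → W.mordellWeilRank = 1 →
          Finite (AddCommGroup.primaryComponent W.sha 3) →
            Finite (IwasawaAlgebra.coinvariants 3 D.H2))
    (h31b : ∀ (W : WeierstrassCurve ℚ) [W.IsElliptic] [W.IsGloballyMinimal]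
      [ContinuousSMul ℤ_[3] (W.tateModule 3)] (D : KatoDescentDatum 3)
      (pin : KatoDescentDatumPinH2 W 3 D), W.j = 0 → W.mordellWeilRank = 1 →
        Finite (AddCommGroup.primaryComponent W.sha 3) →
          (∀ m : ℕ, 3 ^ m • D.ι (Submodule.Quotient.mk D.z) ≠ 0) →
            ∀ t : ℚ_[3], HasLocPKummerLog W 3 pin.katoClass t → t ≠ 0)
    (hPR : PRFormulaAtThreeH2) :
    AnalyticRankOneOfRankOneFiniteShaThree :=
  analyticRankOne_of_facts_of_heegnerNonTorsion hpar hmod hHL hKato hHP hGZ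
    (heegnerNonTorsion_of_prFormulaH2_of_readingsAtPin hKato hRK h31 h31b hPR)

end Summit.BirchSwinnertonDyer.BirchSwinnertonDyer.Theorems.MordellShaFreeCutKatoZetaRoadPinnedH2AtPin

end
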